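import Literature.Computability.Cryptography.WordRAMForward1
import Literature.Computability.Cryptography.WordRAMInline3
import HarnessLib

/-!
# The word RAM — inline simulation with query forwarding, II: oracle sources and the query block

Continuation of `Literature.Computability.Cryptography.WordRAMForward1` (the machine behind the
transitivity of fine-grained reductions, V. Vassilevska Williams–R. Williams, J. ACM 65 (2018),
§3, Prop. 1; VVW ICM 2018, Prop. 2.2):

* `emuO_step`, `emuO_run`, `emuO_halt`: the stamped emulation of
  `Literature.Computability.Cryptography.WordRAMEmulator` for an **oracle source** — the inner
  reduction `M_{BD}` run *with the real oracle* `O` —, its `query` instructions compiled to the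
  forwarding blocks `Inline.QF` (`run_QF`): ordinary steps cost `cstep`, a query `q` costs
  `chargeF O q = qfCost |q| |O q|`, and the target's query log is a fixed prefix followed by the
  source's query log;
* `Inline.QBF`: the query block of the *outer* reduction `M_{AB}` — verbatim the block `Inline.QB`
  of `…WordRAMInline2` (operands, width routine, generation bump, copy-in, inline run, copy-out)
  with the inline program compiled with forwarding blocks — and its specification `run_QBF`: the
  effect of `WordRAM.step` on the `query` of `M_{AB}` with the oracle "output of `M_{BD}` under `O`",
  the target's query log growing by the `D`-queries `M_{BD}` made.

## References

* V. Vassilevska Williams, R. R. Williams, *Subcubic equivalences between path, matrix, and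
  triangle problems*, J. ACM 65 (2018), Art. 27, §3, Prop. 1 (p. 27:10, proof p. 27:11).
  doi:10.1145/3186893
* V. Vassilevska Williams, *On some fine-grained questions in algorithms and complexity*,
  Proc. ICM 2018, §2 (Def. 2.1, Prop. 2.2).
-/

namespace Literature.Computability.Cryptography.WordRAM

open StateTransition

namespace Inline

/-! ## Emulating an oracle source with forwarded queries -/

section emuO

variable {MB : Program} {W wsB VT VB g : ℕ} {P : Program} {base : ℕ}

/-- The cost charged to a forwarded query `q`: its forwarding block. [folklore] -/
def chargeF (O : List ℕ → List ℕ) (q : List ℕ) : ℕ :=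
  qfCost q.length (O q).length

/-- The forwarding blocks have length `qlenF`. [folklore] -/
theorem QF_length' : ∀ pos (qa ql aa : Operand), (QF pos qa ql aa).length = qlenF :=
  fun pos qa ql aa => QF_length pos qa ql aa

/-- **One step of an oracle source, emulated.** Let the compiled inner reduction `M_B` (query
blocks = forwarding blocks) sit at `base`, and let the source configuration `d` (memory
`VB`-bounded, run at word size `wsB` *with the oracle* `O`) be related to the target `e` whose
query log is `pre ++ d.queries`. One source step `d → d'` is matched by a target run — with the
same oracle — to some `e'` related to `d'` with query log `pre ++ d'.queries`; an ordinary step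
costs at most `cstep`, a query `q` costs `chargeF O q`, provided its answer has length `≤ VB`
(`2 VB + 2 ≤ Q`). Only the emulator's temporaries, registers `21–27` and `B`-region cells change.
[folklore] -/
theorem emuO_step (hcode : CodeAt P base (compile LB qlenF MB base QF)) (hW : 8 ≤ W)
    (hwsB : wsB ≤ W) (hVT : VT + 1 = 2 ^ W) (hdet : MB.IsDeterministic)
    (hMV : Program.maxConst MB ≤ VB) (hVBQ : 2 * VB + 2 ≤ Qv W)
    {O : List ℕ → List ℕ} {d d' e : Cfg} {pre : List (List ℕ)}
    (hrel : ERel LB (EB W g wsB) VT MB base qlenF d e) (hq : e.queries = pre ++ d.queries)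
    (hdm : MemLE VB d.mem) (hstep : step MB wsB O zeroCoins d = some d')
    (hO : ∀ q ∈ d'.queries, (O q).length ≤ VB) (ρ' : ℕ → ℕ) :
    ∃ n e', run P W O ρ' n e = some e' ∧ ERel LB (EB W g wsB) VT MB base qlenF d' e' ∧
      e'.queries = pre ++ d'.queries ∧ e'.coinPos = e.coinPos ∧
      (∀ c, c ≠ 12 → c ≠ 13 → c ≠ 14 → ¬ (21 ≤ c ∧ c ≤ 27) → ¬ (2 * Qv W ≤ c ∧ c < 4 * Qv W) →
        e'.mem c = e.mem c) ∧
      n + (d.queries.map (chargeF O)).sum ≤ cstep + (d'.queries.map (chargeF O)).sum := by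
  have hQ := Qv_ge hW
  have h4Q := four_mul_Qv (show 2 ≤ W by omega)
  have hVT1 : 1 ≤ VT := by
    have : 2 ^ 8 ≤ 2 ^ W := Nat.pow_le_pow_right (by norm_num) hW
    omega
  have hVVT : VB ≤ VT := by omega
  have hOK := envOK_B (g := g) hW hwsB
  have hstep' : step MB (EB W g wsB).ws O zeroCoins d = some d' := hstep
  by_cases hnq : ∀ i qa ql aa, d.pc = some i → MB[i]? ≠ some (.query qa ql aa)
  · -- ordinary instruction: the emulator step
    obtain ⟨n, hn, e', hrun, hrel', hco, hqu, hfr⟩ := emu_step (L := LB) (E := EB W g wsB) hOK hVT hVT1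
      (LB_regs_le (by omega)) QF_length' hcode hdet hMV (by simp only [EB_Q]; omega) hVVT O ρ' hrel hdm
      hstep' hnq
    have hqs : d'.queries = d.queries := by
      rcases step_queries hstep with h | ⟨i, qa, ql, aa, hpc, hMi, -⟩
      · exact h
      · exact absurd hMi (hnq i qa ql aa hpc)
    refine ⟨n, e', hrun, hrel', by rw [hqu, hq, hqs], hco, fun c c12 c13 c14 _ cB => hfr c fun hf => ?_,
      by rw [hqs]; omega⟩
    have := foot_B hf; omega
  · -- a query: the forwarding block
    simp only [not_forall, not_not, exists_prop] at hnq
    obtain ⟨i, qa, ql, aa, hpc, hMi⟩ := hnq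
    have hi : i < MB.length := (List.getElem?_eq_some_iff.1 hMi).1
    rw [step_query hpc hMi] at hstep
    simp only [Option.some.injEq] at hstep
    subst hstep
    simp only at hO ⊢
    have hqmem : readSeg d.mem (qa.read d.mem) (ql.read d.mem) ∈
        d.queries ++ [readSeg d.mem (qa.read d.mem) (ql.read d.mem)] :=
      List.mem_append_right _ (List.mem_singleton_self _)
    have hoV := hO _ hqmem
    -- constants of the query instruction
    have hIc : (Instr.query qa ql aa).maxConst ≤ VB := le_trans (Instr.maxConst_le_of_getElem? hMi) hMV
    simp only [Instr.maxConst, max_le_iff] at hIc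
    -- placement of the forwarding block
    have hblk := codeAt_blkAt (L := LB) (qlen := qlenF) (base := base) (qb := QF) QF_length' hcode hi
    simp only [blkAt, hMi] at hblk
    have hpce : e.pc = some (bstart LB qlenF MB base i) := by rw [hrel.pc, hpc]; rfl
    obtain ⟨n, hn, e', hrun, hpc', hB', hco, hqu, hfr⟩ := run_QF (W := W) (VT := VT) (VB := VB) hblk hW hwsB
      hVT hpce ⟨hrel.inv, hrel.agree⟩ hdm hIc.1 hIc.2.1 hIc.2.2 hVBQ hoV ρ'
    refine ⟨n, e', hrun, ⟨?_, hB'.2, hB'.1⟩, by rw [hqu, hq, List.append_assoc], hco,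
      fun c c12 _ c14 cR cB => hfr c c12 c14 cR cB, ?_⟩
    · rw [hpc']
      simp only [Option.getD_some]
      rw [bstart_succ hi]
      simp [blkLenAt, hMi, blkLen]
    · simp only [List.map_append, List.map_cons, List.map_nil, List.sum_append, List.sum_cons,
        List.sum_nil, Nat.add_zero, chargeF, readSeg_length]
      have : cstep = 38 := rfl
      omega

/-- **Runs of an oracle source, emulated.** `n` source steps (word size `wsB`, oracle `O`,
source `VB`-bounded with `2 ^ wsB - 1 ≤ VB`) from a related pair with target query log
`pre ++ d₀.queries` are matched by a target run with the same oracle, ending in a related pair with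
query log `pre ++ dn.queries`, at cost `cstep · n` plus the charges of the queries made, provided
every query in the final log has an answer of length `≤ VB`. [folklore] -/
theorem emuO_run (hcode : CodeAt P base (compile LB qlenF MB base QF)) (hW : 8 ≤ W)
    (hwsB : wsB ≤ W) (hVT : VT + 1 = 2 ^ W) (hdet : MB.IsDeterministic)
    (hMV : Program.maxConst MB ≤ VB) (hV1 : 1 ≤ VB) (hwsV : 2 ^ wsB - 1 ≤ VB)
    (hVBQ : 2 * VB + 2 ≤ Qv W)
    {O : List ℕ → List ℕ} {d₀ e₀ : Cfg} {pre : List (List ℕ)}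
    (hrel : ERel LB (EB W g wsB) VT MB base qlenF d₀ e₀) (hq : e₀.queries = pre ++ d₀.queries)
    (hdm : MemLE VB d₀.mem) (ρ' : ℕ → ℕ) :
    ∀ (n : ℕ) {dn : Cfg}, run MB wsB O zeroCoins n d₀ = some dn →
      (∀ q ∈ dn.queries, (O q).length ≤ VB) →
      ∃ m en, run P W O ρ' m e₀ = some en ∧ ERel LB (EB W g wsB) VT MB base qlenF dn en ∧
        en.queries = pre ++ dn.queries ∧ en.coinPos = e₀.coinPos ∧
        (∀ c, c ≠ 12 → c ≠ 13 → c ≠ 14 → ¬ (21 ≤ c ∧ c ≤ 27) → ¬ (2 * Qv W ≤ c ∧ c < 4 * Qv W) →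
          en.mem c = e₀.mem c) ∧
        m + (d₀.queries.map (chargeF O)).sum ≤ cstep * n + (dn.queries.map (chargeF O)).sum
  | 0, dn, h, _ => by
      simp only [run_zero, Option.some.injEq] at h
      subst h
      exact ⟨0, e₀, rfl, hrel, hq, rfl, fun _ _ _ _ _ _ => rfl, by simp⟩
  | n + 1, dn, h, hO => by
      rw [run_add, Option.bind_eq_some_iff] at h
      obtain ⟨dm, hdm', hlast⟩ := h
      rw [run_one] at hlast
      have hpre := step_queries_prefix hlast
      obtain ⟨m, em, hrun, hrelm, hqm, hcom, hfrm, hcost⟩ := emuO_run hcode hW hwsB hVT hdet hMV hV1 hwsV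
        hVBQ hrel hq hdm ρ' n hdm' fun q hq' => hO q (hpre.subset hq')
      have hmemm : MemLE VB dm.mem :=
        run_memLE_of_queries hwsV hV1 hMV n hdm hdm' fun q hq' => hO q (hpre.subset hq')
      obtain ⟨m', e', hrun', hrel', hq', hco', hfr', hcost'⟩ := emuO_step hcode hW hwsB hVT hdet hMV hVBQ
        hrelm hqm hmemm hlast hO ρ'
      refine ⟨m + m', e', run_add_of_run _ _ _ _ hrun hrun', hrel', hq', by rw [hco', hcom],
        fun c c12 c13 c14 cR cB => by rw [hfr' c c12 c13 c14 cR cB, hfrm c c12 c13 c14 cR cB], ?_⟩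
      rw [Nat.mul_succ]; omega

/-- **Emulating a halting run of an oracle source.** If the deterministic inner reduction `M_B`,
started in `d₀` related to `e₀` (target query log `pre ++ d₀.queries`), reaches the halted
configuration `dh` after `n` steps under the oracle `O`, every query in `dh.queries` having an
answer of length `≤ VB`, then the target (same oracle) reaches, within `cstep · n` plus the query
charges, a configuration at the exit position whose emulated memory is `dh.mem`, with query log
`pre ++ dh.queries`, the target invariant, unchanged coins, and only temporaries, registers
`21–27` and `B`-region cells changed. [folklore] -/
theorem emuO_halt (hcode : CodeAt P base (compile LB qlenF MB base QF)) (hW : 8 ≤ W)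
    (hwsB : wsB ≤ W) (hVT : VT + 1 = 2 ^ W) (hdet : MB.IsDeterministic)
    (hMV : Program.maxConst MB ≤ VB) (hV1 : 1 ≤ VB) (hwsV : 2 ^ wsB - 1 ≤ VB)
    (hVBQ : 2 * VB + 2 ≤ Qv W)
    {O : List ℕ → List ℕ} {d₀ e₀ : Cfg} {pre : List (List ℕ)}
    (hrel : ERel LB (EB W g wsB) VT MB base qlenF d₀ e₀) (hq : e₀.queries = pre ++ d₀.queries)
    (hdm : MemLE VB d₀.mem) (ρ' : ℕ → ℕ)
    {n : ℕ} {dh : Cfg} (hrun : run MB wsB O zeroCoins n d₀ = some dh) (hhalt : dh.pc = none)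
    (hO : ∀ q ∈ dh.queries, (O q).length ≤ VB) :
    ∃ m, m + (d₀.queries.map (chargeF O)).sum ≤ cstep * n + (dh.queries.map (chargeF O)).sum ∧
      ∃ eh, run P W O ρ' m e₀ = some eh ∧
      eh.pc = some (exitPos LB qlenF MB base) ∧ Agree (EB W g wsB) eh.mem dh.mem ∧
      TInv LB (EB W g wsB) VT eh.mem ∧ eh.queries = pre ++ dh.queries ∧ eh.coinPos = e₀.coinPos ∧
      ∀ c, c ≠ 12 → c ≠ 13 → c ≠ 14 → ¬ (21 ≤ c ∧ c ≤ 27) → ¬ (2 * Qv W ≤ c ∧ c < 4 * Qv W) →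
        eh.mem c = e₀.mem c := by
  obtain ⟨m, eh, hrunT, ⟨hpc, hag, hI⟩, hqu, hco, hfr, hcost⟩ :=
    emuO_run hcode hW hwsB hVT hdet hMV hV1 hwsV hVBQ hrel hq hdm ρ' n hrun hO
  refine ⟨m, hcost, eh, hrunT, ?_, hag, hI, hqu, hco, hfr⟩
  rw [hpc, hhalt, Option.getD_none, exitPos]

end emuO

/-! ## The query block with forwarding: code -/

/-- The length of the inner reduction compiled with forwarding blocks (independent of its
position). [folklore] -/
def ℓF (MB : Program) : ℕ := (compile LB qlenF MB 0 QF).length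

/-- **The query block with forwarding** at position `pos` for the source instruction
`query qa ql aa` of the outer reduction: verbatim `Inline.QB` (operands, width routine,
generation bump, copy-in, inline run, copy-out), the inline program now compiled with the
forwarding blocks `Inline.QF`. [folklore] -/
def QBF (MB : Program) (kB pos : ℕ) (qa ql aa : Operand) : List Instr :=
  (Q0 qa ql aa).map OpSpec.toInstr ++ Q1.map OpSpec.toInstr ++ widthCode (pos + 37) kB ++
    Q2.map OpSpec.toInstr ++ Q3.map OpSpec.toInstr ++ loopBlock (pos + 88) 20 cinBody ++
    compile LB qlenF MB (pos + 99) QF ++ Q5.map OpSpec.toInstr ++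
    loopBlock (pos + 112 + ℓF MB) 20 coutBody

/-- The length of the query block with forwarding. [folklore] -/
def qlenMF (MB : Program) : ℕ := 128 + ℓF MB

/-- The length of the inner program compiled with forwarding blocks. [folklore] -/
theorem length_compile_F (MB : Program) (base : ℕ) : (compile LB qlenF MB base QF).length = ℓF MB := by
  have h1 := length_compile (L := LB) (qlen := qlenF) (M := MB) (base := base) (qb := QF) QF_length'
  have h2 := length_compile (L := LB) (qlen := qlenF) (M := MB) (base := 0) (qb := QF) QF_length'
  simp only [exitPos, bstart, Nat.min_self, ℓF] at h1 h2 ⊢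
  omega

/-- The exit position of the inner program compiled with forwarding blocks. [folklore] -/
theorem exitPos_F (MB : Program) (base : ℕ) : exitPos LB qlenF MB base = base + ℓF MB := by
  have h1 := length_compile (L := LB) (qlen := qlenF) (M := MB) (base := base) (qb := QF) QF_length'
  rw [length_compile_F] at h1; omega

/-- Length of the query block with forwarding (`= qlenMF MB`). [folklore] -/
@[simp] theorem QBF_length (MB : Program) (kB pos : ℕ) (qa ql aa : Operand) :
    (QBF MB kB pos qa ql aa).length = qlenMF MB := by
  simp [QBF, qlenMF, length_compile_F]; omega

/-! ## The query block with forwarding: specification -/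

section whole

variable {W ws VT V : ℕ}

/-- **Specification of the query block with forwarding.** Let the query block for `query qa ql aa` sit at `pos`,
let the target configuration `e` (at `pos`) carry the `M`-side for the `V`-bounded source memory
`dmem` and the `B`-side between calls (`BPre`) at generation `g` (register `10`), and let the
deterministic inner reduction `M_B`, run *with the real oracle* `O` at word size
`kB * inputWidth q` on the query segment `q = readSeg dmem (qa.read dmem) (ql.read dmem)`, halt
within `sq` steps in `cB` with output `oq`, `|oq| ≤ V`, every query in `cB.queries` having an
answer of length `≤ VB` (`2 VB + 2 ≤ Q`). Then, under the numeric side conditions, the target —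
run with the same oracle `O` — reaches the end of the block within `qbCost |q| W sq |oq|` plus the
forwarding charges of `cB.queries` steps, its `M`-side now agreeing with the memory of `M` *after*
the query answered by `oq` (`WordRAM.step`: length at `aa`, words reduced modulo `2 ^ ws` after
it), its `B`-side at generation `g + 1`, coins unchanged, and its query log extended by exactly
`cB.queries` (V. Vassilevska Williams–R. Williams 2018, proof of Prop. 1: the oracle call is
replaced by a run of the second reduction, whose own calls go to the oracle). [folklore] -/
theorem run_QBF {P : Program} {MB : Program} {kB pos : ℕ} {qa ql aa : Operand}
    (hcode : CodeAt P pos (QBF MB kB pos qa ql aa)) (hws : ws < W) (hVT : VT + 1 = 2 ^ W)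
    (hBdet : MB.IsDeterministic) {O : List ℕ → List ℕ}
    {e : Cfg} (hpc : e.pc = some pos) {dmem : ℕ → ℕ} (hM : MSide W ws VT dmem e.mem)
    {g : ℕ} (hB : BPre W g e.mem) (h10 : e.mem 10 = g)
    (hdm : MemLE V dmem) (hqa : qa.const ≤ V) (hql : ql.const ≤ V) (haa : aa.const ≤ V) (hV1 : 1 ≤ V)
    {oq : List ℕ} {sq : ℕ} {cB : Cfg}
    (hrunB : HaltsWithin MB (kB * inputWidth (readSeg dmem (qa.read dmem) (ql.read dmem))) O
      zeroCoins (readSeg dmem (qa.read dmem) (ql.read dmem)) sq cB)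
    (houtB : readOut cB.mem = oq) (hoV : oq.length ≤ V)
    (hVQ : 2 * V + 42 ≤ Qv W - 40) (hgT : g + 1 ≤ VT) (hkB : kB * Nat.size V < W) {VB : ℕ}
    (hVB : 2 ^ (kB * Nat.size V) ≤ VB) (hMB : MB.maxConst ≤ VB) (hVBQ : 2 * VB + 2 ≤ Qv W)
    (hOD : ∀ q' ∈ cB.queries, (O q').length ≤ VB) (ρ' : ℕ → ℕ) :
    ∃ n, n ≤ qbCost (ql.read dmem) W sq oq.length + (cB.queries.map (chargeF O)).sum ∧
      ∃ e' : Cfg, run P W O ρ' n e = some e' ∧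
      e'.pc = some (pos + qlenMF MB) ∧
      MSide W ws VT (writeSeg (Function.update dmem (aa.read dmem) (oq.map (· % 2 ^ ws)).length)
        (aa.read dmem + 1) (oq.map (· % 2 ^ ws))) e'.mem ∧
      (∃ wsB, BSide W (g + 1) wsB VT cB.mem e'.mem) ∧ e'.mem 10 = g + 1 ∧
      e'.coinPos = e.coinPos ∧ e'.queries = e.queries ++ cB.queries := by
  -- code placement
  simp only [QBF] at hcode
  obtain ⟨hc0, hc8⟩ := codeAt_append_iff.1 hcode
  obtain ⟨hc0, hc7⟩ := codeAt_append_iff.1 hc0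
  obtain ⟨hc0, hc6⟩ := codeAt_append_iff.1 hc0
  obtain ⟨hc0, hc5⟩ := codeAt_append_iff.1 hc0
  obtain ⟨hc0, hc4⟩ := codeAt_append_iff.1 hc0
  obtain ⟨hc0, hc3⟩ := codeAt_append_iff.1 hc0
  obtain ⟨hc0, hc2⟩ := codeAt_append_iff.1 hc0
  obtain ⟨hc0, hc1⟩ := codeAt_append_iff.1 hc0
  simp only [List.length_append, List.length_map, loopBlock_length, Q0_length, Q1_length,
    widthCode_length, Q2_length, Q3_length, cinBody_length, Q5_length, length_compile_F,
    Nat.add_assoc, Nat.reduceAdd] at hc1 hc2 hc3 hc4 hc5 hc6 hc7 hc8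
  -- constants
  have hW : 8 ≤ W := eight_le_of_Qv (by omega)
  have hOKM := envOK_M hW hws.le
  have hQ := Qv_ge hW
  have h4Q := four_mul_Qv (show 2 ≤ W by omega)
  have h255 : 255 ≤ VT := by
    have : 2 ^ 8 ≤ 2 ^ W := Nat.pow_le_pow_right (by norm_num) hW
    omega
  have hVVT : V ≤ VT := by omega
  have hVBT : VB ≤ VT := by omega
  set a := qa.read dmem with ha
  set L := ql.read dmem with hL
  set ad := aa.read dmem with had
  have haV : a ≤ V := Operand.read_le hdm qa hqa
  have hLV : L ≤ V := Operand.read_le hdm ql hql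
  have hadV : ad ≤ V := Operand.read_le hdm aa haa
  set q := readSeg dmem a L with hq
  have hqlen : q.length = L := readSeg_length _ _ _
  have hiw : inputWidth q ≤ Nat.size V := by
    refine inputWidth_le_size (by rw [hqlen]; exact hLV) hV1 fun v hv => ?_
    obtain ⟨j, -, rfl⟩ := mem_readSeg_iff.1 hv
    exact hdm _
  obtain ⟨wsB, hwsB⟩ : ∃ wsB, kB * inputWidth q = wsB := ⟨_, rfl⟩
  have hwsBW : wsB < W := by rw [← hwsB]; exact lt_of_le_of_lt (Nat.mul_le_mul_left kB hiw) hkB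
  have hwsBV : 2 ^ wsB - 1 ≤ VB := by
    rw [← hwsB]
    have := Nat.pow_le_pow_right (show 0 < 2 by norm_num) (Nat.mul_le_mul_left kB hiw); omega
  have hVB1 : 1 ≤ VB := le_trans Nat.one_le_two_pow hVB
  rw [hwsB] at hrunB
  obtain ⟨pc0, m0, cp, qs⟩ := e
  simp only at hpc hM hB h10
  subst hpc
  -- phase 0 (36 steps)
  obtain ⟨M1, r15, r16, r17, f1⟩ := execOps_Q0 hws.le hVT hM hdm (by omega) hVVT qa ql aa hqa hql haa
  have r1 := run_ops (P := P) (w := W) (O := O) (ρ := ρ') (Q0 qa ql aa) hc0 (c := ⟨some pos, m0, cp, qs⟩) rfl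
  set m1 := execOps W m0 (Q0 qa ql aa) with hm1
  have B1 : BPre W g m1 := hB.of_frame fun c hc => f1 c (by omega) (by omega) (by omega) (by omega)
  -- phase 1 (1 step)
  obtain ⟨s31, f2⟩ := execOps_Q1 (W := W) m1 (by rw [r15]; omega)
  have r2 := run_ops (P := P) (w := W) (O := O) (ρ := ρ') Q1 hc1 (c := ⟨some (pos + 36), m1, cp, qs⟩) rfl
  set m2 := execOps W m1 Q1 with hm2
  have T2 : MemLE VT m2 := fun c => by
    rcases eq_or_ne c 31 with rfl | hc
    · rw [s31, r15]; omega
    · rw [f2 c hc]; exact M1.1.memT c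
  have M2 : MSide W ws VT dmem m2 := M1.of_frame hW T2 fun c hc => f2 c (by omega)
  have B2 : BPre W g m2 := B1.of_frame fun c hc => f2 c (by omega)
  -- the width routine
  have hseg2 : readSeg m2 (40 + a) L = q := readSeg_M_eq M2 (by omega)
  obtain ⟨n3, hn3, m3, r3, s30, -, f3, T3'⟩ := run_widthCode (P := P) (W := W) (O := O) (ρ := ρ')
    (i₀ := pos + 37) (kk := kB) hc2 (c := ⟨some (pos + 37), m2, cp, qs⟩) rfl
    (fun c => by have := T2 c; simp only at this ⊢; omega) (p := 40 + a) (L := L)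
    (by simp only; rw [f2 _ (by decide), r16]) (by simp only; rw [s31, r15]) (by omega) (by omega)
    (by simp only; rw [hseg2, hwsB]; exact hwsBW)
  simp only [] at r3 s30 f3
  rw [hseg2, hwsB] at s30
  have T3 : MemLE VT m3 := fun c => by have := T3' c; omega
  have M3 : MSide W ws VT dmem m3 := M2.of_frame hW T3 fun c hc => f3 c (by omega)
  have B3 : BPre W g m3 := B2.of_frame fun c hc => f3 c (by omega)
  -- phase 2 (7 steps)
  have h10₃ : m3 10 = g := by
    rw [f3 _ (by omega), f2 _ (by decide), f1 _ (by decide) (by decide) (by decide) (by decide), h10]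
  have h16₃ : m3 16 = L := by rw [f3 _ (by omega), f2 _ (by decide), r16]
  obtain ⟨M4, B4, s10, s11, f4⟩ := execOps_Q2 hW hVT M3 B3 le_rfl h10₃ s30 h16₃ hwsBW hgT
  have r4 := run_ops (P := P) (w := W) (O := O) (ρ := ρ') Q2 hc3 (c := ⟨some (pos + 78), m3, cp, qs⟩) rfl
  set m4 := execOps W m3 Q2 with hm4
  rw [← dmB_zero dmem wsB L a] at B4
  -- phase 3 (3 steps)
  have h15₄ : m4 15 = a := by
    rw [f4 _ (by omega) (by omega) (by omega) (by omega) (by omega), f3 _ (by omega), f2 _ (by decide), r15]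
  obtain ⟨s19, s20, s32, f5⟩ := execOps_Q3 (W := W) m4 (by rw [h15₄]; omega)
  have r5 := run_ops (P := P) (w := W) (O := O) (ρ := ρ') Q3 hc4 (c := ⟨some (pos + 85), m4, cp, qs⟩) rfl
  set m5 := execOps W m4 Q3 with hm5
  have T5 : MemLE VT m5 := fun c => by
    by_cases c19 : c = 19; · rw [c19, s19, h15₄]; omega
    by_cases c20 : c = 20; · rw [c20, s20, f4 _ (by omega) (by omega) (by omega) (by omega) (by omega), h16₃]; omega
    by_cases c32 : c = 32; · rw [c32, s32]; omega
    rw [f5 c c19 c20 c32]; exact M4.1.memT c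
  have M5 : MSide W ws VT dmem m5 := M4.of_frame hW T5 fun c hc => f5 c (by omega) (by omega) (by omega)
  have B5 : BSide W (g + 1) wsB VT (dmB dmem wsB L a 0) m5 :=
    B4.of_frame hW T5 fun c hc => f5 c (by omega) (by omega) (by omega)
  -- copy-in loop (`L` rounds)
  have hcin := iterate_cinBody hVT hwsBW.le M5 B5 (by rw [s19, h15₄])
    (by rw [s20, f4 _ (by omega) (by omega) (by omega) (by omega) (by omega), h16₃]) s32 (by omega)
  have r6 := run_while (P := P) (w := W) (O := O) (ρ := ρ') hc5 L (c := ⟨some (pos + 88), m5, cp, qs⟩) rfl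
    (fun j hj => by
      show ((fun m => execOps W m cinBody)^[j] m5) 20 ≠ 0
      rw [(hcin j hj.le).2.2.2.1]; omega)
    (by show ((fun m => execOps W m cinBody)^[L] m5) 20 = 0; rw [(hcin L le_rfl).2.2.2.1]; omega)
  simp only [] at r6
  obtain ⟨M6, B6, -, -, -, f6⟩ := hcin L le_rfl
  set m6 := (fun m => execOps W m cinBody)^[L] m5 with hm6
  have B6' : BSide W (g + 1) wsB VT (init wsB q).mem m6 :=
    ⟨B6.1, Agree.congr_right B6.2 fun b => dmB_eq_init b⟩
  -- the run of `M_B`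
  have hOKB := envOK_B (g := g + 1) hW hwsBW.le
  obtain ⟨nB, hnB, hrunMB, hstepB⟩ := hrunB.exists_run
  have hhaltB : cB.pc = none := (step_eq_none_iff _ _ _ _ _).1 hstepB
  have hrel : ERel LB (EB W (g + 1) wsB) VT MB (pos + 99) qlenF (init wsB q) ⟨some (pos + 99), m6, cp, qs⟩ :=
    ⟨by simp [bstart_zero], B6'.2, B6'.1⟩
  obtain ⟨n7, hn7, e7, r7, pc7, ag7, I7, qu7, co7, f7⟩ := emuO_halt (W := W) (wsB := wsB) (VT := VT)
    (VB := VB) (g := g + 1) (P := P) (base := pos + 99) (MB := MB) hc6 hW hwsBW.le hVT hBdet hMB hVB1 hwsBV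
    hVBQ (pre := qs) hrel (by simp) (init_memLE _ _ hwsBV) ρ' hrunMB hhaltB hOD
  obtain ⟨pc7', m7, cp7, qs7⟩ := e7
  simp only at pc7 ag7 I7 co7 qu7 f7 r7
  subst pc7' cp7 qs7
  rw [exitPos_F] at r7
  have M7 : MSide W ws VT dmem m7 := M6.of_frame hW I7.memT fun c hc =>
    f7 c (by omega) (by omega) (by omega) (by omega) (by omega)
  have B7 : BSide W (g + 1) wsB VT cB.mem m7 := ⟨I7, ag7⟩
  -- the answer
  have hlo : cB.mem 0 = oq.length := by rw [← houtB, readOut_length]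
  have hout : ∀ i, i < oq.length → cB.mem (1 + i) = oq[i]! := by
    intro i hi
    have h1 : (readOut cB.mem)[i]! = oq[i]! := by rw [houtB]
    rw [← h1, getElem!_pos (readOut cB.mem) i (by rw [readOut_length, hlo]; exact hi)]
    simp [readOut, readSeg, List.getElem_map, List.getElem_range]
  -- phase 5 (13 steps)
  have h17₇ : m7 17 = ad := by
    rw [f7 17 (by omega) (by omega) (by omega) (by omega) (by omega), f6 _ (by omega) (by omega) (by omega)
      (by omega) (by omega) (by omega), f5 _ (by omega) (by omega) (by omega),
      f4 _ (by omega) (by omega) (by omega) (by omega) (by omega), f3 _ (by omega), f2 _ (by decide), r17]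
  obtain ⟨M8, B8, s34, s33, s32', s20', f8⟩ := execOps_Q5 hws.le hVT hwsBW.le M7 B7 h17₇ (by omega)
    (by rw [hlo]; omega)
  have r8 := run_ops (P := P) (w := W) (O := O) (ρ := ρ') Q5 hc7
    (c := ⟨some (pos + 99 + ℓF MB), m7, cp, qs ++ cB.queries⟩) (by simp only [Nat.add_assoc])
  set m8 := execOps W m7 Q5 with hm8
  rw [hlo] at M8 s20'
  -- copy-out loop (`|oq|` rounds)
  have hcout := iterate_coutBody hws.le hVT hwsBW.le M8 B8 hout s32' s33 s20' (by omega)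
  rw [show pos + (112 + ℓF MB) = pos + (99 + (ℓF MB + 13)) by omega] at hc8
  have r9 := run_while (P := P) (w := W) (O := O) (ρ := ρ') hc8 oq.length
    (c := ⟨some (pos + (99 + (ℓF MB + 13))), m8, cp, qs ++ cB.queries⟩) rfl
    (fun j hj => by
      show ((fun m => execOps W m coutBody)^[j] m8) 20 ≠ 0
      rw [(hcout j hj.le).2.2.2.2.1]; omega)
    (by show ((fun m => execOps W m coutBody)^[oq.length] m8) 20 = 0; rw [(hcout _ le_rfl).2.2.2.2.1]; omega)
  simp only [] at r9
  obtain ⟨M9, B9, -, -, -, f9⟩ := hcout _ le_rfl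
  set m9 := (fun m => execOps W m coutBody)^[oq.length] m8 with hm9
  rw [dmM_length] at M9
  -- assemble
  simp only [Q0_length, Q1_length, Q2_length, Q3_length, cinBody_length, Q5_length, coutBody_length,
    Nat.add_assoc, Nat.reduceAdd] at r1 r2 r3 r4 r5 r6 r7 r8 r9
  refine ⟨36 + (1 + (n3 + (7 + (3 + ((L * 11 + 1) + (n7 + (13 + (oq.length * 16 + 1)))))))),
    ?_, ⟨some (pos + qlenMF MB), m9, cp, qs ++ cB.queries⟩, ?_, rfl, ?_, ⟨wsB, B9⟩, ?_, rfl, rfl⟩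
  · simp only [qbCost]
    simp only [widthCost] at hn3
    have : cstep = 38 := rfl
    rw [this] at hn7
    simp only [init_queries, List.map_nil, List.sum_nil, Nat.add_zero] at hn7
    have := Nat.mul_le_mul_left 38 hnB
    omega
  · have hrun := run_add_of_run _ _ _ _ r1 (run_add_of_run _ _ _ _ r2 (run_add_of_run _ _ _ _ r3
      (run_add_of_run _ _ _ _ r4 (run_add_of_run _ _ _ _ r5 (run_add_of_run _ _ _ _ r6
      (run_add_of_run _ _ _ _ r7 (run_add_of_run _ _ _ _ r8 r9)))))))
    convert hrun using 4; simp only [qlenMF]; omega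
  · simpa only [List.length_map] using M9
  · show m9 10 = g + 1
    rw [f9 _ (by omega) (by omega) (by omega) (by omega) (by omega) (by omega),
      f8 _ (by omega) (by omega) (by omega) (by omega) (by omega) (by omega),
      f7 10 (by omega) (by omega) (by omega) (by omega) (by omega),
      f6 _ (by omega) (by omega) (by omega) (by omega) (by omega) (by omega),
      f5 _ (by omega) (by omega) (by omega), s10]

end whole

end Inline

end Literature.Computability.Cryptography.WordRAM
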